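import Summits.CriticalPhenomena.PercolationContinuityZ3.Theorems.PercNearOneGluingNoHeavyLowerTailKnQuestion8CoefficientwiseRootSectorTwo
import HarnessLib

/-!
# The point row when the root is adjacent only to the two points (prim-lf-2 gen 41, THEOREM T41.1)

Support file (`--supports stmt-CriticalPhenomena-4575`, closed), prover `prim-lf-2` (gen 41).  No definitions, no named facts, no sorries;
standard axioms.  Memo `prim-lf-2/CW-ROOTPOINTS-gen41.md`; notation of `prim-lf-2/CW-POINTS-gen32.md` and of
`…CoefficientwiseRootSectorTwo` (gen 37/38, whose sector identity this file instantiates).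

Setting.  Multigraph `ends : ι → Sym2 V` on an edge set `E`, root `x`, wall SET `Z ∌ x`, colourings `s ⊔ (E ∖ s)`, red cluster `K s = C_x(s)`,
blue cluster `K (E ∖ s)`, `σ_v(s) = 1[v ∈ K s] − 1[v ∈ K (E ∖ s)]`, wall event `W_E = {s : Z ∩ (K s ∪ K (E∖s)) = ∅}`; the POINT ROW of the
coefficientwise vdBHK-PA programme is the conjecture `0 ≤ Σ_{W_E} σ_u σ_w` (CW-POINTS-gen32; open in general).

**THEOREM (this file).**  If the only edges of `E` at `x` are `e₁ = {x,u}` and `e₂ = {x,w}` — the root is adjacent to the two points and to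
nothing else — then `0 ≤ Σ_{W_E} σ_u σ_w`, for every wall set `Z ∌ x` and every graph `H = G − x` behind the points.
Proof ("Harris twice", the pattern of Linusson's one-post bunkbed lemma).  By the root-sector identity (`pointRow_rootDegTwo_eq` with
`p = u`, `q = w`) the sum equals `2·N_pure + 2·M` over colourings `t` of `E' = E ∖ {e₁,e₂}`, where in the pure sector `u, w ∈ C_u(t) ∪ C_w(t)`
automatically, so `N_pure = L := #{t : Z ∩ C_u(t) = ∅ = Z ∩ C_w(t)}`, and in the mixed sector `σ_u = 1 − 1[u ∈ C_w(E'∖t)] ≥ 0`,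
`σ_w = 1[w ∈ C_u t] − 1 ≤ 0`, so every term is `≥ −1` and `M ≥ −#{t : Z ∩ C_u(t) = ∅, Z ∩ C_w(E' ∖ t) = ∅}`.  The last event is the
intersection of a decreasing and an increasing event of `t`, so by Harris/FKG on the cube (`fkg_powerset`) its size is at most
`#{Z ∩ C_u(t) = ∅} · #{Z ∩ C_w(E'∖t) = ∅} / 2^{|E'|} = #{Z ∩ C_u(t) = ∅} · #{Z ∩ C_w(t) = ∅} / 2^{|E'|}` (reindex `t ↦ E' ∖ t`), which by
Harris again (two decreasing events) is at most `#{Z ∩ C_u(t) = ∅ ∧ Z ∩ C_w(t) = ∅} = L`.  Hence `N_pure + M ≥ L − L = 0`.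
This is the near-tight family `N(x) = {u,w}` of the gen-38 hunts (CANDIDATES G38.5, min ratio 1.0022) — a theorem, tight exactly when Harris is.
* `Coefficientwise.card_dec_inter_reflect_le` — the two FKG steps for 0/1 functions on `E'.powerset`: a decreasing event meets the reflection `t ↦ E' ∖ t`
  of another decreasing event at most as often as it meets the event itself.
* `Coefficientwise.pointRow_nonneg_of_rootAdjPoints` — **THE THEOREM**.
[cite: KozmaNitzan2024, Questions 8–9 (§5.5 p. 36) (context: the Question-8 pocket covariance programme; the inequality used is Harris–FKG)]
-/

namespace Summit.CriticalPhenomena.PercolationContinuityZ3.Theorems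

open Finset Literature.Probability.Percolation

namespace Coefficientwise

variable {ι V : Type*} (ends : ι → Sym2 V)

section fkg

variable [DecidableEq ι] [Fintype ι]

/-- Two decreasing 0/1 events `A`, `B` of the colouring and the reflected event `t ↦ B (E ∖ t)` (increasing): Harris/FKG twice on the cube gives
`#{t ⊆ E : A t ∧ B (E ∖ t)} ≤ #{t ⊆ E : A t ∧ B t}` — a decreasing event meets the REFLECTION of another decreasing event at most as often as it
meets the event itself.  (Abstract form; `A`, `B` arbitrary antitone predicates on `Finset ι`.)
[cite: KozmaNitzan2024, §5.5 (context only; the inequality is Harris 1960 / Fortuin–Kasteleyn–Ginibre)] -/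
theorem card_dec_inter_reflect_le (E : Finset ι) (A B : Finset ι → Prop) [DecidablePred A] [DecidablePred B]
    (hA : ∀ s t : Finset ι, s ⊆ t → A t → A s) (hB : ∀ s t : Finset ι, s ⊆ t → B t → B s) :
    ((E.powerset.filter (fun t => A t ∧ B (E \ t))).card : ℝ) ≤ ((E.powerset.filter (fun t => A t ∧ B t)).card : ℝ) := by
  -- 0/1 functions
  set fA : Finset ι → ℝ := fun t => if A t then 1 else 0 with hfA
  set fB : Finset ι → ℝ := fun t => if B t then 1 else 0 with hfB
  set gB : Finset ι → ℝ := fun t => fB (E \ t) with hgB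
  have hfA_anti : Antitone fA := by
    intro s t hst; simp only [hfA]
    by_cases ht : A t
    · rw [if_pos ht, if_pos (hA s t hst ht)]
    · rw [if_neg ht]; split_ifs <;> norm_num
  have hfB_anti : Antitone fB := by
    intro s t hst; simp only [hfB]
    by_cases ht : B t
    · rw [if_pos ht, if_pos (hB s t hst ht)]
    · rw [if_neg ht]; split_ifs <;> norm_num
  have hgB_mono : Monotone gB := by
    intro s t hst; simp only [hgB]
    exact hfB_anti (Finset.sdiff_subset_sdiff (le_refl E) hst)
  have h1A : Monotone (fun t => 1 - fA t) := fun s t hst => by linarith [hfA_anti hst]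
  have h1B : Monotone (fun t => 1 - fB t) := fun s t hst => by linarith [hfB_anti hst]
  -- the two cardinalities as sums of products
  have hcard₂ : ((E.powerset.filter (fun t => A t ∧ B (E \ t))).card : ℝ) = ∑ t ∈ E.powerset, fA t * gB t := by
    rw [Finset.card_filter, Nat.cast_sum]
    refine Finset.sum_congr rfl fun t _ => ?_
    simp only [hfA, hgB, hfB]
    by_cases ha : A t <;> by_cases hb : B (E \ t) <;> simp [ha, hb]
  have hcard₁ : ((E.powerset.filter (fun t => A t ∧ B t)).card : ℝ) = ∑ t ∈ E.powerset, fA t * fB t := by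
    rw [Finset.card_filter, Nat.cast_sum]
    refine Finset.sum_congr rfl fun t _ => ?_
    simp only [hfA, hfB]
    by_cases ha : A t <;> by_cases hb : B t <;> simp [ha, hb]
  -- constants
  have hN : ∑ t ∈ E.powerset, (1 : ℝ) = (2 ^ E.card : ℝ) := by
    rw [Finset.sum_const, Finset.card_powerset]; simp
  have hNpos : (0 : ℝ) < (2 ^ E.card : ℝ) := by positivity
  -- reflection: Σ gB = Σ fB
  have hrefl : ∑ t ∈ E.powerset, gB t = ∑ t ∈ E.powerset, fB t := by
    simp only [hgB]; exact sum_powerset_sdiff E fB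
  -- FKG 1: (Σ (1 - fA)) (Σ gB) ≤ N Σ (1 - fA) gB, i.e. N Σ fA gB ≤ (Σ fA)(Σ gB)
  have i1 := fkg_powerset E (fun t => 1 - fA t) gB h1A hgB_mono
  -- FKG 2: (Σ (1 - fA)) (Σ (1 - fB)) ≤ N Σ (1 - fA)(1 - fB), i.e. (Σ fA)(Σ fB) ≤ N Σ fA fB
  have i2 := fkg_powerset E (fun t => 1 - fA t) (fun t => 1 - fB t) h1A h1B
  have e1 : ∑ t ∈ E.powerset, (1 - fA t) = (2 ^ E.card : ℝ) - ∑ t ∈ E.powerset, fA t := by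
    rw [Finset.sum_sub_distrib, hN]
  have e2 : ∑ t ∈ E.powerset, (1 - fB t) = (2 ^ E.card : ℝ) - ∑ t ∈ E.powerset, fB t := by
    rw [Finset.sum_sub_distrib, hN]
  have e3 : ∑ t ∈ E.powerset, (1 - fA t) * gB t = (∑ t ∈ E.powerset, gB t) - ∑ t ∈ E.powerset, fA t * gB t := by
    simp only [sub_mul, one_mul, Finset.sum_sub_distrib]
  have e4 : ∑ t ∈ E.powerset, (1 - fA t) * (1 - fB t) =
      (2 ^ E.card : ℝ) - (∑ t ∈ E.powerset, fA t) - (∑ t ∈ E.powerset, fB t) + ∑ t ∈ E.powerset, fA t * fB t := by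
    have : ∀ t, (1 - fA t) * (1 - fB t) = 1 - fA t - fB t + fA t * fB t := fun t => by ring
    simp only [this, Finset.sum_add_distrib, Finset.sum_sub_distrib, hN]
  rw [e1, e3] at i1
  rw [e1, e2, e4] at i2
  rw [hrefl] at i1
  -- chain: N·card₂ ≤ ΣfA·ΣfB ≤ N·card₁
  have step1 : (2 ^ E.card : ℝ) * ∑ t ∈ E.powerset, fA t * gB t ≤ (∑ t ∈ E.powerset, fA t) * ∑ t ∈ E.powerset, fB t := by
    nlinarith [i1]
  have step2 : (∑ t ∈ E.powerset, fA t) * (∑ t ∈ E.powerset, fB t) ≤ (2 ^ E.card : ℝ) * ∑ t ∈ E.powerset, fA t * fB t := by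
    nlinarith [i2]
  rw [hcard₂, hcard₁]
  by_contra hlt
  push Not at hlt
  have : (2 ^ E.card : ℝ) * ∑ t ∈ E.powerset, fA t * fB t < (2 ^ E.card : ℝ) * ∑ t ∈ E.powerset, fA t * gB t :=
    mul_lt_mul_of_pos_left hlt hNpos
  linarith

end fkg

section main

variable [DecidableEq ι] [Fintype ι]

open Classical in
/-- **THEOREM T41.1 (prim-lf-2 gen 41): the point row holds when the root is adjacent only to the two points.**
Let the only edges of `E` at `x` be `e₁ ≠ e₂` with `ends e₁ = {x,u}`, `ends e₂ = {x,w}`, `u, w ≠ x`, and let `Z ∌ x` be any wall set.  Then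
`0 ≤ Σ_{s ⊆ E : ∀ z ∈ Z, z ∉ C_x(s), z ∉ C_x(E ∖ s)} σ_u(s)·σ_w(s)`.  Proof: the root-sector identity `pointRow_nonneg_of_rootDegTwo` with `p = u`,
`q = w`; in the pure sector every wall colouring counts `+1`, in the mixed sector every wall colouring counts `≥ −1`, and
`card_dec_inter_reflect_le` (Harris twice) bounds the mixed wall event `{Z ∩ C_u(t) = ∅} ∩ {Z ∩ C_w(E'∖t) = ∅}` by the pure one
`{Z ∩ C_u(t) = ∅} ∩ {Z ∩ C_w(t) = ∅}`.  [cite: KozmaNitzan2024, Questions 8–9 (§5.5 p. 36) (context; the inequality used is Harris–FKG)] -/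
theorem pointRow_nonneg_of_rootAdjPoints (E : Finset ι) {x u w : V} {e₁ e₂ : ι} (he₁ : e₁ ∈ E) (he₂ : e₂ ∈ E) (hne : e₁ ≠ e₂)
    (h₁ : ends e₁ = s(x, u)) (h₂ : ends e₂ = s(x, w)) (hroot : ∀ i ∈ E, x ∈ ends i → i = e₁ ∨ i = e₂)
    (hux : u ≠ x) (hwx : w ≠ x) (Z : Set V) (hxZ : x ∉ Z) :
    0 ≤ ∑ s ∈ E.powerset.filter (fun s : Finset ι => ∀ z ∈ Z, z ∉ openCluster (ends '' (↑(s) : Set ι)) x ∧ z ∉ openCluster (ends '' (↑(E \ s) : Set ι)) x),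
      ((if u ∈ openCluster (ends '' (↑(s) : Set ι)) x then (1 : ℝ) else 0) - (if u ∈ openCluster (ends '' (↑(E \ s) : Set ι)) x then (1 : ℝ) else 0)) *
        ((if w ∈ openCluster (ends '' (↑(s) : Set ι)) x then (1 : ℝ) else 0) - (if w ∈ openCluster (ends '' (↑(E \ s) : Set ι)) x then (1 : ℝ) else 0)) := by
  apply pointRow_nonneg_of_rootDegTwo ends E he₁ he₂ hne h₁ h₂ hroot u w hux hwx Z hxZ
  set E' : Finset ι := (E.erase e₁).erase e₂ with hE'
  -- the pure sector: every term is 1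
  have hpure : ∑ t ∈ E'.powerset.filter (fun t : Finset ι => ∀ z ∈ Z,
          z ∉ openCluster (ends '' (↑(t) : Set ι)) u ∧ z ∉ openCluster (ends '' (↑(t) : Set ι)) w),
      (if (u ∈ openCluster (ends '' (↑(t) : Set ι)) u ∨ u ∈ openCluster (ends '' (↑(t) : Set ι)) w) then (1 : ℝ) else 0) *
        (if (w ∈ openCluster (ends '' (↑(t) : Set ι)) u ∨ w ∈ openCluster (ends '' (↑(t) : Set ι)) w) then (1 : ℝ) else 0) =
      ((E'.powerset.filter (fun t : Finset ι => ∀ z ∈ Z,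
          z ∉ openCluster (ends '' (↑(t) : Set ι)) u ∧ z ∉ openCluster (ends '' (↑(t) : Set ι)) w)).card : ℝ) := by
    rw [Finset.card_eq_sum_ones, Nat.cast_sum]
    refine Finset.sum_congr rfl fun t _ => ?_
    rw [if_pos (Or.inl (mem_openCluster_self _ _)), if_pos (Or.inr (mem_openCluster_self _ _))]
    simp
  -- the mixed sector: every term is ≥ -1
  have hmixed : -(((E'.powerset.filter (fun t : Finset ι => ∀ z ∈ Z,
          z ∉ openCluster (ends '' (↑(t) : Set ι)) u ∧ z ∉ openCluster (ends '' (↑(E' \ t) : Set ι)) w)).card : ℝ)) ≤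
      ∑ t ∈ E'.powerset.filter (fun t : Finset ι => ∀ z ∈ Z,
          z ∉ openCluster (ends '' (↑(t) : Set ι)) u ∧ z ∉ openCluster (ends '' (↑(E' \ t) : Set ι)) w),
      ((if u ∈ openCluster (ends '' (↑(t) : Set ι)) u then (1 : ℝ) else 0) -
          (if u ∈ openCluster (ends '' (↑(E' \ t) : Set ι)) w then (1 : ℝ) else 0)) *
        ((if w ∈ openCluster (ends '' (↑(t) : Set ι)) u then (1 : ℝ) else 0) -
          (if w ∈ openCluster (ends '' (↑(E' \ t) : Set ι)) w then (1 : ℝ) else 0)) := by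
    rw [Finset.card_eq_sum_ones, Nat.cast_sum, ← Finset.sum_neg_distrib]
    refine Finset.sum_le_sum fun t _ => ?_
    rw [if_pos (mem_openCluster_self _ _), if_pos (mem_openCluster_self _ _)]
    split_ifs <;> norm_num
  -- Harris twice
  have hfkg := card_dec_inter_reflect_le E'
    (fun t : Finset ι => ∀ z ∈ Z, z ∉ openCluster (ends '' (↑(t) : Set ι)) u)
    (fun t : Finset ι => ∀ z ∈ Z, z ∉ openCluster (ends '' (↑(t) : Set ι)) w)
    (fun s t hst ht z hz hzs => (ht z hz) (openCluster_image_mono ends hst u hzs))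
    (fun s t hst ht z hz hzs => (ht z hz) (openCluster_image_mono ends hst w hzs))
  -- rewrite the two filters of `hfkg` into the filters of the goal (∀-∧ distribution)
  have hf₂ : E'.powerset.filter (fun t : Finset ι => (∀ z ∈ Z, z ∉ openCluster (ends '' (↑(t) : Set ι)) u) ∧
        (∀ z ∈ Z, z ∉ openCluster (ends '' (↑(E' \ t) : Set ι)) w)) =
      E'.powerset.filter (fun t : Finset ι => ∀ z ∈ Z,
          z ∉ openCluster (ends '' (↑(t) : Set ι)) u ∧ z ∉ openCluster (ends '' (↑(E' \ t) : Set ι)) w) := by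
    refine Finset.filter_congr fun t _ => ?_
    exact ⟨fun h z hz => ⟨h.1 z hz, h.2 z hz⟩, fun h => ⟨fun z hz => (h z hz).1, fun z hz => (h z hz).2⟩⟩
  have hf₁ : E'.powerset.filter (fun t : Finset ι => (∀ z ∈ Z, z ∉ openCluster (ends '' (↑(t) : Set ι)) u) ∧
        (∀ z ∈ Z, z ∉ openCluster (ends '' (↑(t) : Set ι)) w)) =
      E'.powerset.filter (fun t : Finset ι => ∀ z ∈ Z,
          z ∉ openCluster (ends '' (↑(t) : Set ι)) u ∧ z ∉ openCluster (ends '' (↑(t) : Set ι)) w) := by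
    refine Finset.filter_congr fun t _ => ?_
    exact ⟨fun h z hz => ⟨h.1 z hz, h.2 z hz⟩, fun h => ⟨fun z hz => (h z hz).1, fun z hz => (h z hz).2⟩⟩
  rw [hf₂, hf₁] at hfkg
  rw [hpure]
  linarith

end main

end Coefficientwise

end Summit.CriticalPhenomena.PercolationContinuityZ3.Theorems
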